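import Literature.NumberTheory.Weil1964.MatrixAddHaarModule
import Literature.NumberTheory.Automorphic.LocalFieldHaarBalls
import Literature.NumberTheory.Automorphic.GodementJacquetLocalNonvanishing
import HarnessLib

/-!
# The Haar measure of `GL_n(F)` over a non-archimedean local field in additive coordinates: `d^×X = ‖det X‖_F^{-n} dX`
# (Weil, *Basic Number Theory*, Chap. I §4; Rogawski 1990, §1.7 «`dg = |ω|`»)

Topic `NumberTheory/Weil1964`; namespace `Literature.NumberTheory.Weil1964`.  KERNEL mathematics only (theorems; no definition, no named
fact, no instance, no notation, no `sorry`): the measure is spelled as the EXPLICIT TERM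
  `Measure.comap (Units.val : GL n F → Matrix n n F) (dX.withDensity fun X => ((normAbs F X.det⁻¹ : ℝ≥0) : ℝ≥0∞) ^ Fintype.card n)`
in every head (the style of ★ `LocalFieldHaar.isHaarMeasure_unitsMeasure`, the case `n = 1`).  Cell `pub/hodgecm-mathlib`, F0∕P3a, seat
F0P3a-p08 (g11); LEAD DESK WORD T6-52: part (II) of the brick «D-T1a» of the #88 repair census
`F0/P3a/F0P3a-p05/g9/SIZING-S1prime.v2.F0P3a-p05g9.md` §5, road D-T1 `GaugeFormMeasure` (the `|ω|_v` ∕ Tamagawa measures behind (K7-s) and print's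
`m(Z_H∖H)` constants [Rogawski1990 §1.7 p. 6, Thm. 14.5.1 p. 234]).  It is the NON-ARCHIMEDEAN TWIN, head for head, of ★
`Literature/MeasureTheory/Group/UnitsHaarDensity.lean` (`d^×x = |N_{A∕ℝ}(x)|⁻¹ dx` on the units of a real algebra), with `‖det X‖_F^{-n}` in place of
`|N_{A∕ℝ}(X)|⁻¹` (for `A = M_n`, `N(X) = det Xⁿ`), over ★ part (I) `MatrixAddHaarModule` (`(X ↦ gX)_* dX = (X ↦ Xg)_* dX = (‖det g‖⁻¹)ⁿ dX`).

Setting: `F` a non-archimedean local field, `n` a finite index type, Borel structures on `M_n(F) = Matrix n n F` and on `GL n F = (Matrix n n F)ˣ` as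
HYPOTHESES (Godement–Jacquet style; no instance is declared), `dX` ANY additive Haar measure on `M_n(F)`.
* §1 `measurableEmbedding_generalLinearGroup_val` (★ `isOpenEmbedding_generalLinearGroup_val`), images of translates.
* §2 the density `X ↦ (‖det X‖_F⁻¹)ⁿ` (written `((normAbs F X.det⁻¹ : ℝ≥0) : ℝ≥0∞) ^ Fintype.card n`): multiplicative, `1` at `1`, non-zero exactly
  at the units, measurable, continuous on `GL`.
* §3 `glHaar_apply`, **`lintegral_glHaar`** — `∫_{GL} G(↑g) d^×g = ∫_{X unit} G(X) (‖det X‖⁻¹)ⁿ dX` for measurable `G ≥ 0`.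
* §4 **`isMulLeftInvariant_glHaar`**, **`isMulRightInvariant_glHaar`** (part (I) + multiplicativity), `isFiniteMeasureOnCompacts_glHaar`,
  `isOpenPosMeasure_glHaar`, **`isHaarMeasure_glHaar`** — `‖det X‖_F^{-n} dX` IS A LEFT AND RIGHT INVARIANT HAAR MEASURE ON `GL_n(F)`.
* §5 **`exists_lintegral_gl_eq_mul_lintegral`** — EVERY Haar measure `ρ` on `GL_n(F)` is `c • ‖det X‖^{-n} dX`, `c ∈ (0, ∞)`:
  `∫_{GL} G(↑g) dρ = c ∫_{X unit} G(X) (‖det X‖⁻¹)ⁿ dX` (Haar uniqueness; `GL_n(F)` is second countable and locally compact), and the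
  integrability transfer `integrable_comp_val_of_integrable`.
HONEST LABEL: HC_CM is proved only modulo the printed citations until rung 0 closes; count-neutral generic brick (no stub closes).

## References
* [WeilBNT1967] A. Weil, *Basic Number Theory*, Grundlehren 144 (1967), Chap. I §2 (module), §4 (`M_n` and its units over a `p`-field),
  Chap. II §1.
* [Rogawski1990] J. D. Rogawski, *Automorphic Representations of Unitary Groups in Three Variables*, Ann. of Math. Stud. 123 (1990), §1.7 p. 6
  («`dg = |ω|`»), Thm. 14.5.1 p. 234.
* [Tate1950] J. Tate, *Fourier analysis in number fields and Hecke's zeta-functions*, §2.2–2.3 (`d^×x = |x|⁻¹ dx`).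
* [GodementJacquet1972] R. Godement, H. Jacquet, *Zeta functions of simple algebras*, LNM 260 (1972), §3 (local zeta integrals against `d^×X`).
-/

set_option autoImplicit false

noncomputable section

open MeasureTheory MeasureTheory.Measure ValuativeRel Filter Topology Set Matrix
open scoped NNReal ENNReal MatrixGroups
open Literature.NumberTheory.GaloisRepresentations.IsNonarchimedeanLocalField
open Literature.NumberTheory.Automorphic

namespace Literature.NumberTheory.Weil1964

variable {F : Type*} [Field F] [ValuativeRel F] [TopologicalSpace F] [IsNonarchimedeanLocalField F]
variable {n : Type*} [Fintype n] [DecidableEq n]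

/-! ## §1 `GL_n(F) ↪ M_n(F)`: a measurable open embedding -/

section Embedding

omit [ValuativeRel F] [TopologicalSpace F] [IsNonarchimedeanLocalField F] in
/-- The range of `Units.val : GL n F → M_n(F)` is the set of invertible matrices. [folklore] -/
private theorem range_val_eq : Set.range (Units.val : GL n F → Matrix n n F) = {X | IsUnit X} :=
  Set.ext fun _ => ⟨fun ⟨u, hu⟩ => hu ▸ u.isUnit, fun h => ⟨h.unit, h.unit_spec⟩⟩

/-- `F` is a Hausdorff topological field with continuous inversion (instance helpers). [folklore] -/
private theorem t1Space_F : T1Space F :=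
  haveI : T2Space F := (Literature.NumberTheory.GaloisRepresentations.IsNonarchimedeanLocalField.isLocalField F).toT2Space
  inferInstance

omit [ValuativeRel F] [TopologicalSpace F] [IsNonarchimedeanLocalField F] in
/-- The image under `val` of a left translate: `val '' ((u * ·)⁻¹' s) = (↑u * ·)⁻¹' (val '' s)`. [folklore] -/
private theorem image_val_preimage_mul_left (u : GL n F) (s : Set (GL n F)) :
    Units.val '' ((fun v : GL n F => u * v) ⁻¹' s) = (fun X : Matrix n n F => (u : Matrix n n F) * X) ⁻¹' (Units.val '' s) := by
  ext X
  constructor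
  · rintro ⟨v, hv, rfl⟩
    exact ⟨u * v, hv, by rw [Units.val_mul]⟩
  · rintro ⟨w, hw, hwx⟩
    refine ⟨u⁻¹ * w, ?_, ?_⟩
    · show u * (u⁻¹ * w) ∈ s
      rwa [mul_inv_cancel_left]
    · show ((u⁻¹ * w : GL n F) : Matrix n n F) = X
      rw [Units.val_mul, hwx, ← mul_assoc, Units.inv_mul, one_mul]

omit [ValuativeRel F] [TopologicalSpace F] [IsNonarchimedeanLocalField F] in
/-- The image under `val` of a right translate: `val '' ((· * u)⁻¹' s) = (· * ↑u)⁻¹' (val '' s)`. [folklore] -/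
private theorem image_val_preimage_mul_right (u : GL n F) (s : Set (GL n F)) :
    Units.val '' ((fun v : GL n F => v * u) ⁻¹' s) = (fun X : Matrix n n F => X * (u : Matrix n n F)) ⁻¹' (Units.val '' s) := by
  ext X
  constructor
  · rintro ⟨v, hv, rfl⟩
    exact ⟨v * u, hv, by rw [Units.val_mul]⟩
  · rintro ⟨w, hw, hwx⟩
    refine ⟨w * u⁻¹, ?_, ?_⟩
    · show w * u⁻¹ * u ∈ s
      rwa [inv_mul_cancel_right]
    · show ((w * u⁻¹ : GL n F) : Matrix n n F) = X
      rw [Units.val_mul, hwx, mul_assoc, Units.mul_inv, mul_one]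

variable [MeasurableSpace (Matrix n n F)] [BorelSpace (Matrix n n F)] [MeasurableSpace (GL n F)] [BorelSpace (GL n F)]

/-- **`GL_n(F) ↪ M_n(F)` is a measurable embedding** for the Borel structures (it is an open embedding, ★ `isOpenEmbedding_generalLinearGroup_val`;
Mathlib `IsOpenEmbedding.measurableEmbedding`). [cite: WeilBNT1967, Chap. I §4] -/
theorem measurableEmbedding_generalLinearGroup_val : MeasurableEmbedding (Units.val : GL n F → Matrix n n F) :=
  haveI := t1Space_F (F := F)
  (isOpenEmbedding_generalLinearGroup_val (m := n) (F := F)).measurableEmbedding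

end Embedding

/-! ## §2 The density `X ↦ (‖det X‖_F⁻¹)ⁿ` -/

section Density

/-- multiplicativity: `(‖det(XY)‖⁻¹)ⁿ = (‖det X‖⁻¹)ⁿ (‖det Y‖⁻¹)ⁿ`. [cite: WeilBNT1967, Chap. I §4] -/
theorem glDensity_mul (X Y : Matrix n n F) :
    ((normAbs F (X * Y).det⁻¹ : ℝ≥0) : ℝ≥0∞) ^ Fintype.card n =
      ((normAbs F X.det⁻¹ : ℝ≥0) : ℝ≥0∞) ^ Fintype.card n * ((normAbs F Y.det⁻¹ : ℝ≥0) : ℝ≥0∞) ^ Fintype.card n := by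
  rw [Matrix.det_mul, mul_inv, map_mul, ENNReal.coe_mul, mul_pow]

/-- the density at `1` is `1`. [cite: WeilBNT1967, Chap. I §4] -/
theorem glDensity_one : ((normAbs F (1 : Matrix n n F).det⁻¹ : ℝ≥0) : ℝ≥0∞) ^ Fintype.card n = 1 := by
  rw [Matrix.det_one, inv_one, map_one, ENNReal.coe_one, one_pow]

/-- the density does not vanish at an invertible matrix. [cite: WeilBNT1967, Chap. I §4] -/
theorem glDensity_ne_zero_of_isUnit {X : Matrix n n F} (hX : IsUnit X) :
    ((normAbs F X.det⁻¹ : ℝ≥0) : ℝ≥0∞) ^ Fintype.card n ≠ 0 := by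
  have hdet : X.det ≠ 0 := ((Matrix.isUnit_iff_isUnit_det X).1 hX).ne_zero
  exact pow_ne_zero _ (ENNReal.coe_ne_zero.2 ((map_ne_zero (normAbs F)).2 (inv_ne_zero hdet)))

/-- the density is finite everywhere. [folklore] -/
private theorem glDensity_ne_top (X : Matrix n n F) : ((normAbs F X.det⁻¹ : ℝ≥0) : ℝ≥0∞) ^ Fintype.card n ≠ ⊤ :=
  ENNReal.pow_ne_top ENNReal.coe_ne_top

/-- `X ↦ ‖det X‖_F⁻¹` is continuous on the invertible matrices (into `ℝ≥0`; `‖·‖_F` is continuous, ★ `LocalFieldHaar.continuous_normAbs`).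
[cite: WeilBNT1967, Chap. I §4] -/
theorem continuousOn_normAbs_det_inv :
    ContinuousOn (fun X : Matrix n n F => (normAbs F X.det⁻¹ : ℝ≥0)) {X | IsUnit X} := by
  have hc : Continuous fun X : Matrix n n F => normAbs F X.det := LocalFieldHaar.continuous_normAbs.comp continuous_id.matrix_det
  refine ContinuousOn.congr (f := fun X : Matrix n n F => (normAbs F X.det)⁻¹) (hc.continuousOn.inv₀ fun X hX => ?_) fun X _ => ?_
  · exact (map_ne_zero (normAbs F)).2 ((Matrix.isUnit_iff_isUnit_det X).1 hX).ne_zero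
  · simp only [map_inv₀]

variable [MeasurableSpace (Matrix n n F)] [BorelSpace (Matrix n n F)]

/-- the density is Borel measurable (`det` is continuous, `‖·‖_F` is continuous, `x ↦ x⁻¹` is measurable on `ℝ≥0`). [cite: WeilBNT1967, Chap. I §4] -/
theorem measurable_glDensity : Measurable fun X : Matrix n n F => ((normAbs F X.det⁻¹ : ℝ≥0) : ℝ≥0∞) ^ Fintype.card n := by
  have hc : Continuous fun X : Matrix n n F => normAbs F X.det := LocalFieldHaar.continuous_normAbs.comp continuous_id.matrix_det
  have hm : Measurable fun X : Matrix n n F => (normAbs F X.det⁻¹ : ℝ≥0) := by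
    simp_rw [map_inv₀]
    exact hc.measurable.inv
  exact (hm.coe_nnreal_ennreal).pow_const _

end Density

/-! ## §3 The measure `‖det X‖⁻ⁿ dX` on `GL_n(F)`: values and integrals computed on `M_n(F)` -/

section Values

variable [MeasurableSpace (Matrix n n F)] [BorelSpace (Matrix n n F)] [MeasurableSpace (GL n F)] [BorelSpace (GL n F)]
  (dX : Measure (Matrix n n F))

/-- **value on a measurable set**: `(‖det‖⁻ⁿ dX)(s) = ∫⁻_{val '' s} (‖det X‖⁻¹)ⁿ dX` for measurable `s ⊆ GL_n(F)`. [cite: WeilBNT1967, Chap. I §4] -/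
theorem glHaar_apply {s : Set (GL n F)} (hs : MeasurableSet s) :
    Measure.comap (Units.val : GL n F → Matrix n n F)
        (dX.withDensity fun X => ((normAbs F X.det⁻¹ : ℝ≥0) : ℝ≥0∞) ^ Fintype.card n) s =
      ∫⁻ X in Units.val '' s, ((normAbs F X.det⁻¹ : ℝ≥0) : ℝ≥0∞) ^ Fintype.card n ∂dX := by
  rw [measurableEmbedding_generalLinearGroup_val.comap_apply,
    withDensity_apply _ (measurableEmbedding_generalLinearGroup_val.measurableSet_image.2 hs)]

/-- **`∫_{GL_n(F)} G(↑g) ‖det g‖⁻ⁿ dX` computed on `M_n(F)`**: for measurable `G ≥ 0` on `M_n(F)`,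
`∫⁻ G(↑g) d(‖det‖⁻ⁿ dX)(g) = ∫⁻_{X unit} G(X) (‖det X‖⁻¹)ⁿ dX`. [cite: WeilBNT1967, Chap. I §4] [cite: GodementJacquet1972, §3] -/
theorem lintegral_glHaar {G : Matrix n n F → ℝ≥0∞} (hG : Measurable G) :
    ∫⁻ g, G (g : Matrix n n F) ∂Measure.comap (Units.val : GL n F → Matrix n n F)
        (dX.withDensity fun X => ((normAbs F X.det⁻¹ : ℝ≥0) : ℝ≥0∞) ^ Fintype.card n) =
      ∫⁻ X in {X : Matrix n n F | IsUnit X}, G X * ((normAbs F X.det⁻¹ : ℝ≥0) : ℝ≥0∞) ^ Fintype.card n ∂dX := by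
  have hme := measurableEmbedding_generalLinearGroup_val (F := F) (n := n)
  have hS : MeasurableSet {X : Matrix n n F | IsUnit X} := by
    rw [← range_val_eq]; exact hme.measurableSet_range
  rw [← hme.lintegral_map G, hme.map_comap, range_val_eq, restrict_withDensity hS,
    lintegral_withDensity_eq_lintegral_mul _ measurable_glDensity hG]
  refine lintegral_congr fun X => ?_
  simp only [Pi.mul_apply, mul_comm]

end Values

/-! ## §4 `‖det X‖⁻ⁿ dX` is a left and right invariant Haar measure on `GL_n(F)` -/

section Haar

variable [MeasurableSpace (Matrix n n F)] [BorelSpace (Matrix n n F)] [MeasurableSpace (GL n F)] [BorelSpace (GL n F)]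
  (dX : Measure (Matrix n n F)) [dX.IsAddHaarMeasure]

/-- **Left invariance of `‖det X‖⁻ⁿ dX`.** For `u ∈ GL_n(F)`, `X ↦ u X` pushes `dX` to `(‖det u‖⁻¹)ⁿ dX` (★ part (I) `map_mul_left_eq_smul`), which is
exactly compensated by `(‖det X‖⁻¹)ⁿ = (‖det u⁻¹‖⁻¹)ⁿ (‖det(uX)‖⁻¹)ⁿ`. [cite: WeilBNT1967, Chap. I §4] [cite: Rogawski1990, §1.7 p. 6] -/
theorem isMulLeftInvariant_glHaar :
    (Measure.comap (Units.val : GL n F → Matrix n n F)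
      (dX.withDensity fun X => ((normAbs F X.det⁻¹ : ℝ≥0) : ℝ≥0∞) ^ Fintype.card n)).IsMulLeftInvariant := by
  refine ⟨fun u => Measure.ext fun s hs => ?_⟩
  have hme := measurableEmbedding_generalLinearGroup_val (F := F) (n := n)
  rw [map_apply (measurable_const_mul u) hs, glHaar_apply dX (measurable_const_mul u hs), glHaar_apply dX hs, image_val_preimage_mul_left]
  set T : Set (Matrix n n F) := Units.val '' s with hT
  have hTm : MeasurableSet T := hme.measurableSet_image.2 hs
  set D : Matrix n n F → ℝ≥0∞ := fun X => ((normAbs F X.det⁻¹ : ℝ≥0) : ℝ≥0∞) ^ Fintype.card n with hD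
  have hDm : Measurable D := measurable_glDensity
  have hdet : (u : Matrix n n F).det ≠ 0 := ((Matrix.isUnit_iff_isUnit_det _).1 u.isUnit).ne_zero
  have hfm : Measurable fun X : Matrix n n F => (u : Matrix n n F) * X := (continuous_const.matrix_mul continuous_id).measurable
  set G : Matrix n n F → ℝ≥0∞ := fun Y => D ((u⁻¹ : GL n F) : Matrix n n F) * D Y with hG
  have hGm : Measurable G := hDm.const_mul _
  calc ∫⁻ X in (fun X : Matrix n n F => (u : Matrix n n F) * X) ⁻¹' T, D X ∂dX
      = ∫⁻ X, ((fun X : Matrix n n F => (u : Matrix n n F) * X) ⁻¹' T).indicator D X ∂dX := by rw [lintegral_indicator (hfm hTm)]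
    _ = ∫⁻ X, (T.indicator G) ((u : Matrix n n F) * X) ∂dX := by
        refine lintegral_congr fun X => ?_
        rw [← Set.indicator_comp_right]
        by_cases hX : X ∈ (fun X : Matrix n n F => (u : Matrix n n F) * X) ⁻¹' T
        · rw [indicator_of_mem hX, indicator_of_mem hX, Function.comp_apply, hG]
          show D X = D ((u⁻¹ : GL n F) : Matrix n n F) * D ((u : Matrix n n F) * X)
          rw [← glDensity_mul, ← mul_assoc, Units.inv_mul, one_mul]
        · rw [indicator_of_notMem hX, indicator_of_notMem hX]
    _ = D (u : Matrix n n F) * ∫⁻ Y, T.indicator G Y ∂dX := lintegral_comp_mul_left dX hdet (hGm.indicator hTm)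
    _ = D (u : Matrix n n F) * (D ((u⁻¹ : GL n F) : Matrix n n F) * ∫⁻ Y in T, D Y ∂dX) := by
        rw [lintegral_indicator hTm, hG, lintegral_const_mul _ hDm]
    _ = ∫⁻ Y in T, D Y ∂dX := by
        rw [← mul_assoc, ← glDensity_mul, Units.mul_inv, glDensity_one, one_mul]

/-- **Right invariance of `‖det X‖⁻ⁿ dX`** (★ part (I) `map_mul_right_eq_smul`; `GL_n(F)` is unimodular). [cite: WeilBNT1967, Chap. I §4] [cite: Rogawski1990, §1.7 p. 6] -/
theorem isMulRightInvariant_glHaar :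
    (Measure.comap (Units.val : GL n F → Matrix n n F)
      (dX.withDensity fun X => ((normAbs F X.det⁻¹ : ℝ≥0) : ℝ≥0∞) ^ Fintype.card n)).IsMulRightInvariant := by
  refine ⟨fun u => Measure.ext fun s hs => ?_⟩
  have hme := measurableEmbedding_generalLinearGroup_val (F := F) (n := n)
  rw [map_apply (measurable_mul_const u) hs, glHaar_apply dX (measurable_mul_const u hs), glHaar_apply dX hs, image_val_preimage_mul_right]
  set T : Set (Matrix n n F) := Units.val '' s with hT
  have hTm : MeasurableSet T := hme.measurableSet_image.2 hs
  set D : Matrix n n F → ℝ≥0∞ := fun X => ((normAbs F X.det⁻¹ : ℝ≥0) : ℝ≥0∞) ^ Fintype.card n with hD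
  have hDm : Measurable D := measurable_glDensity
  have hdet : (u : Matrix n n F).det ≠ 0 := ((Matrix.isUnit_iff_isUnit_det _).1 u.isUnit).ne_zero
  have hfm : Measurable fun X : Matrix n n F => X * (u : Matrix n n F) := (continuous_id.matrix_mul continuous_const).measurable
  set G : Matrix n n F → ℝ≥0∞ := fun Y => D Y * D ((u⁻¹ : GL n F) : Matrix n n F) with hG
  have hGm : Measurable G := hDm.mul_const _
  calc ∫⁻ X in (fun X : Matrix n n F => X * (u : Matrix n n F)) ⁻¹' T, D X ∂dX
      = ∫⁻ X, ((fun X : Matrix n n F => X * (u : Matrix n n F)) ⁻¹' T).indicator D X ∂dX := by rw [lintegral_indicator (hfm hTm)]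
    _ = ∫⁻ X, (T.indicator G) (X * (u : Matrix n n F)) ∂dX := by
        refine lintegral_congr fun X => ?_
        by_cases hX : X * (u : Matrix n n F) ∈ T
        · rw [indicator_of_mem (show X ∈ (fun X : Matrix n n F => X * (u : Matrix n n F)) ⁻¹' T from hX), indicator_of_mem hX, hG]
          show D X = D (X * (u : Matrix n n F)) * D ((u⁻¹ : GL n F) : Matrix n n F)
          rw [← glDensity_mul, mul_assoc, Units.mul_inv, mul_one]
        · rw [indicator_of_notMem (show X ∉ (fun X : Matrix n n F => X * (u : Matrix n n F)) ⁻¹' T from hX), indicator_of_notMem hX]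
    _ = D (u : Matrix n n F) * ∫⁻ Y, T.indicator G Y ∂dX := lintegral_comp_mul_right dX hdet (hGm.indicator hTm)
    _ = D (u : Matrix n n F) * ((∫⁻ Y in T, D Y ∂dX) * D ((u⁻¹ : GL n F) : Matrix n n F)) := by
        rw [lintegral_indicator hTm, hG, lintegral_mul_const _ hDm]
    _ = ∫⁻ Y in T, D Y ∂dX := by
        rw [mul_comm (∫⁻ Y in T, D Y ∂dX), ← mul_assoc, ← glDensity_mul, Units.mul_inv, glDensity_one, one_mul]

/-- `‖det X‖⁻ⁿ dX` is finite on compact subsets of `GL_n(F)` (the density is continuous, hence bounded, on the compact image in `M_n(F)`).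
[cite: WeilBNT1967, Chap. I §4] -/
theorem isFiniteMeasureOnCompacts_glHaar :
    IsFiniteMeasureOnCompacts (Measure.comap (Units.val : GL n F → Matrix n n F)
      (dX.withDensity fun X => ((normAbs F X.det⁻¹ : ℝ≥0) : ℝ≥0∞) ^ Fintype.card n)) := by
  haveI := t1Space_F (F := F)
  haveI : T2Space F := (Literature.NumberTheory.GaloisRepresentations.IsNonarchimedeanLocalField.isLocalField F).toT2Space
  haveI : T2Space (GL n F) := (isOpenEmbedding_generalLinearGroup_val (m := n) (F := F)).isEmbedding.t2Space
  refine ⟨fun C hC => ?_⟩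
  rw [glHaar_apply dX hC.isClosed.measurableSet]
  have hC' : IsCompact (Units.val '' C) := hC.image Units.continuous_val
  have hsub : Units.val '' C ⊆ {X : Matrix n n F | IsUnit X} := by
    rintro _ ⟨u, -, rfl⟩; exact u.isUnit
  have hcont : ContinuousOn (fun X : Matrix n n F => (normAbs F X.det⁻¹ : ℝ≥0) ^ Fintype.card n) (Units.val '' C) :=
    (continuousOn_normAbs_det_inv.mono hsub).pow _
  obtain ⟨M, hM⟩ := hC'.bddAbove_image hcont
  have hbound : ∀ X ∈ Units.val '' C, ((normAbs F X.det⁻¹ : ℝ≥0) : ℝ≥0∞) ^ Fintype.card n ≤ (M : ℝ≥0∞) := fun X hX => by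
    rw [← ENNReal.coe_pow, ENNReal.coe_le_coe]
    exact hM ⟨X, hX, rfl⟩
  calc ∫⁻ X in Units.val '' C, ((normAbs F X.det⁻¹ : ℝ≥0) : ℝ≥0∞) ^ Fintype.card n ∂dX
      ≤ ∫⁻ _ in Units.val '' C, (M : ℝ≥0∞) ∂dX := setLIntegral_mono measurable_const hbound
    _ = (M : ℝ≥0∞) * dX (Units.val '' C) := setLIntegral_const _ _
    _ < ⊤ := ENNReal.mul_lt_top ENNReal.coe_lt_top hC'.measure_lt_top

/-- `‖det X‖⁻ⁿ dX` charges every non-empty open subset of `GL_n(F)` (its image is a non-empty open subset of `M_n(F)`, of positive additive Haar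
measure, on which the density does not vanish). [cite: WeilBNT1967, Chap. I §4] -/
theorem isOpenPosMeasure_glHaar :
    (Measure.comap (Units.val : GL n F → Matrix n n F)
      (dX.withDensity fun X => ((normAbs F X.det⁻¹ : ℝ≥0) : ℝ≥0∞) ^ Fintype.card n)).IsOpenPosMeasure := by
  haveI := t1Space_F (F := F)
  refine ⟨fun U hU hne => ?_⟩
  have hU' : IsOpen (Units.val '' U) := isOpen_image_generalLinearGroup_val hU
  rw [glHaar_apply dX hU.measurableSet, ← withDensity_apply _ hU'.measurableSet, Ne,
    withDensity_apply_eq_zero' measurable_glDensity.aemeasurable]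
  have hsub : Units.val '' U ⊆ {X : Matrix n n F | ((normAbs F X.det⁻¹ : ℝ≥0) : ℝ≥0∞) ^ Fintype.card n ≠ 0} ∩ Units.val '' U := by
    rintro _ ⟨u, hu, rfl⟩
    exact ⟨glDensity_ne_zero_of_isUnit u.isUnit, u, hu, rfl⟩
  exact fun h0 => (hU'.measure_pos dX (hne.image _)).ne' (measure_mono_null hsub h0)

/-- **`‖det X‖_F^{-n} dX` IS A HAAR MEASURE ON `GL_n(F)`** — the classical multiplicative Haar measure of `M_n(F)ˣ` in additive coordinates
(`n = 1`: ★ `LocalFieldHaar.isHaarMeasure_unitsMeasure`; the measure `d^×X` of the Godement–Jacquet local zeta integrals); it is also RIGHT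
invariant (`isMulRightInvariant_glHaar`). [cite: WeilBNT1967, Chap. I §4] [cite: Rogawski1990, §1.7 p. 6] [cite: GodementJacquet1972, §3] -/
theorem isHaarMeasure_glHaar :
    (Measure.comap (Units.val : GL n F → Matrix n n F)
      (dX.withDensity fun X => ((normAbs F X.det⁻¹ : ℝ≥0) : ℝ≥0∞) ^ Fintype.card n)).IsHaarMeasure :=
  have := isMulLeftInvariant_glHaar dX
  have := isFiniteMeasureOnCompacts_glHaar dX
  have := isOpenPosMeasure_glHaar dX
  {}

end Haar

/-! ## §5 Every Haar measure on `GL_n(F)` is `c ‖det X‖⁻ⁿ dX` -/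

section Unique

/-- `GL_n(F)` is second countable and locally compact (instance helpers: open subspace of `M_n(F)`). [folklore] -/
private theorem secondCountable_locallyCompact_gl : SecondCountableTopology (GL n F) ∧ LocallyCompactSpace (GL n F) := by
  haveI := t1Space_F (F := F)
  haveI : SecondCountableTopology F := secondCountableTopology_localField F
  haveI : LocallyCompactSpace F :=
    (Literature.NumberTheory.GaloisRepresentations.IsNonarchimedeanLocalField.isLocalField F).toLocallyCompactSpace
  haveI : SecondCountableTopology (Matrix n n F) := by
    change SecondCountableTopology (n → n → F); infer_instance
  haveI : LocallyCompactSpace (Matrix n n F) := by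
    change LocallyCompactSpace (n → n → F); infer_instance
  exact ⟨(isOpenEmbedding_generalLinearGroup_val (m := n) (F := F)).isEmbedding.secondCountableTopology,
    (isOpenEmbedding_generalLinearGroup_val (m := n) (F := F)).locallyCompactSpace⟩

variable [MeasurableSpace (Matrix n n F)] [BorelSpace (Matrix n n F)] [MeasurableSpace (GL n F)] [BorelSpace (GL n F)]
  (dX : Measure (Matrix n n F)) [dX.IsAddHaarMeasure]

/-- **EVERY HAAR MEASURE ON `GL_n(F)` IS A POSITIVE MULTIPLE OF `‖det X‖^{-n} dX`**: for a Haar measure `ρ` on `GL_n(F)` there is `c ∈ (0, ∞)` with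
`∫_{GL} G(↑g) dρ(g) = c ∫_{X unit} G(X) (‖det X‖_F⁻¹)ⁿ dX` for every measurable `G ≥ 0` on `M_n(F)` (Haar uniqueness on the second countable locally
compact group `GL_n(F)`, Mathlib `isMulLeftInvariant_eq_smul`, applied to `isHaarMeasure_glHaar`). [cite: WeilBNT1967, Chap. I §4] [cite: Rogawski1990, §1.7 p. 6] -/
theorem exists_lintegral_gl_eq_mul_lintegral (ρ : Measure (GL n F)) [ρ.IsHaarMeasure] :
    ∃ c : ℝ≥0, 0 < c ∧ ∀ G : Matrix n n F → ℝ≥0∞, Measurable G →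
      ∫⁻ g, G (g : Matrix n n F) ∂ρ =
        c * ∫⁻ X in {X : Matrix n n F | IsUnit X}, G X * ((normAbs F X.det⁻¹ : ℝ≥0) : ℝ≥0∞) ^ Fintype.card n ∂dX := by
  obtain ⟨h2, hlc⟩ := secondCountable_locallyCompact_gl (F := F) (n := n)
  haveI := h2
  haveI := hlc
  haveI := isHaarMeasure_glHaar dX
  refine ⟨ρ.haarScalarFactor (Measure.comap (Units.val : GL n F → Matrix n n F)
      (dX.withDensity fun X => ((normAbs F X.det⁻¹ : ℝ≥0) : ℝ≥0∞) ^ Fintype.card n)),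
    haarScalarFactor_pos_of_isHaarMeasure _ _, fun G hG => ?_⟩
  conv_lhs => rw [isMulLeftInvariant_eq_smul ρ (Measure.comap (Units.val : GL n F → Matrix n n F)
      (dX.withDensity fun X => ((normAbs F X.det⁻¹ : ℝ≥0) : ℝ≥0∞) ^ Fintype.card n))]
  rw [lintegral_smul_measure, lintegral_glHaar dX hG]
  rfl

/-- **Integrability criterion.** For a Haar measure `ρ` on `GL_n(F)` and a Borel measurable `G : M_n(F) → ℝ`: if `X ↦ (‖det X‖⁻¹)ⁿ G(X)` is
integrable on the invertible matrices for `dX`, then `g ↦ G(↑g)` is `ρ`-integrable — how the convergence of an integral over `GL_n(F)` against `d^×X`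
is read off from an integral over `M_n(F)` against additive Haar measure. [cite: GodementJacquet1972, §3] [cite: WeilBNT1967, Chap. I §4] -/
theorem integrable_comp_val_of_integrable (ρ : Measure (GL n F)) [ρ.IsHaarMeasure] {G : Matrix n n F → ℝ} (hGm : Measurable G)
    (hG : Integrable (fun X => ((normAbs F X.det⁻¹ : ℝ≥0) : ℝ) ^ Fintype.card n * G X) (dX.restrict {X : Matrix n n F | IsUnit X})) :
    Integrable (fun g : GL n F => G (g : Matrix n n F)) ρ := by
  obtain ⟨c, -, hc⟩ := exists_lintegral_gl_eq_mul_lintegral dX ρ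
  refine ⟨(hGm.comp measurableEmbedding_generalLinearGroup_val.measurable).aestronglyMeasurable, ?_⟩
  have hfin := hG.hasFiniteIntegral
  rw [hasFiniteIntegral_iff_enorm] at hfin ⊢
  have key := hc (fun X => ‖G X‖ₑ) hGm.enorm
  have heq : ∫⁻ X in {X : Matrix n n F | IsUnit X}, ‖G X‖ₑ * ((normAbs F X.det⁻¹ : ℝ≥0) : ℝ≥0∞) ^ Fintype.card n ∂dX =
      ∫⁻ X in {X : Matrix n n F | IsUnit X}, ‖((normAbs F X.det⁻¹ : ℝ≥0) : ℝ) ^ Fintype.card n * G X‖ₑ ∂dX := by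
    refine lintegral_congr fun X => ?_
    rw [enorm_mul, enorm_pow, mul_comm, Real.enorm_eq_ofReal (NNReal.coe_nonneg _), ENNReal.ofReal_coe_nnreal]
  calc ∫⁻ g, ‖G (g : Matrix n n F)‖ₑ ∂ρ
      = c * ∫⁻ X in {X : Matrix n n F | IsUnit X}, ‖G X‖ₑ * ((normAbs F X.det⁻¹ : ℝ≥0) : ℝ≥0∞) ^ Fintype.card n ∂dX := key
    _ < ⊤ := by
      rw [heq]
      exact ENNReal.mul_lt_top ENNReal.coe_lt_top hfin

end Unique

end Literature.NumberTheory.Weil1964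

end
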